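import Literature.Analysis.ODE.TorusFlowGradientEstimate
import HarnessLib

/-!
# Armstrong–Vicol App. A Prop. 7.11 on the forward window `[0,T]`, with the time-regularity of the flow
# taken as data (slab-in-time flows): `TorusFlow.dnorm_flowGrad_le_forward_ofDeriv`

Analysis/ODE proof file (theorems only; no definitions, no named facts). This is the FORWARD half
(`0 ≤ t ≤ T = 1/(4dC_fR_f)`) of `Literature.Analysis.ODE.TorusFlowGradientEstimate`
(`abs_partialDeriv_disp_le_forward`, `abs_iteratedFDeriv_flow_le_forward` and the `dnorm` packaging of
`ArmstrongVicol2025_flowGrad_holds`), with the joint space-time smoothness hypotheses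
`IsSmoothSpaceTimeOn univ f`, `IsSmoothSpaceTimeOn univ D` REPLACED by exactly what the printed
induction consumes:

* `hfs : ∀ t, IsSmooth (f t)`, `hDs : ∀ t, IsSmooth (D t)` (smooth time slices), and
* `hDt : ∀ l i t x, HasDerivAt (s ↦ ∂^l Dᵢ(s,·)(x)) (∂^l (fᵢ(t, · + proj D(t,·)))(x)) t` — the
  "chain rule on steroids" `∂ₜ∂^l D = ∂^l (f ∘ X)` (the conclusion of
  `TorusFlow.hasDerivAt_iterPartialDeriv_disp`, which derived it from joint smoothness) taken as DATA;
  with `l = []` it is the flow ODE `∂ₜD(t,x) = f(t, x + proj D(t,x))` itself, so no separate ODE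
  hypothesis is needed.

Flows that are smooth in space but only piecewise-smooth (one-sided slab smooth) in time — e.g. the
Lagrangian flows of lattice words with trapezoid time envelopes — satisfy these hypotheses but not
`IsSmoothSpaceTimeOn univ`. The proofs are those of the parent file line by line (Grönwall on the
variational equation for `s = 1`; the Faà di Bruno remainder bound `Torus.norm_faaDiBrunoRemainder_le_of_coord`
and Grönwall with forcing for the step; `4W_{n+1} ≤ n!`, `ρ_t ≤ 24dR_f` for the packaging); the
public arithmetic helpers (`avWeight_*`, `prod_range_half_eq`, `four_mul_avWeight_succ_le_factorial`,
`abs_partialDeriv_apply_le_of_dnorm_one`) are imported from the parent file.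

## Contents

* `abs_partialDeriv_disp_le_forward_ofDeriv` — `|∂ₖDᵢ(t,x)| ≤ 8dC_fR_f t` on `[0,T]` (Prop. 7.10).
* `abs_iteratedFDeriv_flow_le_forward_ofDeriv` — `|(Dˢ(id + D(t)∘proj)(v)(e_K))_j| ≤ W_s ρ_tˢ/((s+1)² d R_f)`,
  `1 ≤ s ≤ N`, `t ∈ [0,T]` ((eq:Dn:Psi:induction)).
* `dnorm_flowGrad_le_forward_ofDeriv` — `⟦(∇X)_{ij}(t,·)⟧_{n, 8dR_f(1+8dC_fR_f t)} ≤ 6d` for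
  `1 ≤ n ≤ N − 1`, `t ∈ [0,T]` ((e.ODE.flow.estimate), forward window).

## References

* S. Armstrong, V. Vicol, *Anomalous diffusion by fractal homogenization*, Ann. PDE 11 (2025),
  arXiv:2305.05048, App. A Prop. 7.10 (first display), Prop. 7.11 ((e.ODE.flow.estimate),
  (eq:Dn:Psi:induction), (eq:chain:rule:steroids), (eq:E:old:bound)). [`ArmstrongVicol2025`]
* P. Hartman, *Ordinary Differential Equations* (2nd ed., SIAM 2002), Ch. V Thm 3.1 (differentiation
  of solutions with respect to initial data: the variational equation). [`Hartman2002`]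
-/

noncomputable section

open Set Function Filter MeasureTheory Finset
open scoped Topology Nat ContDiff

namespace Literature.Analysis.ODE

namespace TorusFlow

open Literature.Analysis.FunctionSpaces Literature.Analysis.FunctionSpaces.Torus

variable {d : Type*} [Fintype d] [DecidableEq d]

variable {f D : ℝ → UnitAddTorus d → EuclideanSpace ℝ d} {Cf Rf : ℝ} {N : ℕ}

/-! ## §1 The base case: `|∂ₖDᵢ(t,x)| ≤ 8dC_fR_f t` on `[0,T]` -/

omit [Fintype d] [DecidableEq d] in
/-- `e^{x} ≤ 16/15` for `0 ≤ x ≤ 1/16`. [folklore] -/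
private theorem exp_le_of_le_sixteenth' {x : ℝ} (h : x ≤ 1 / 16) : Real.exp x ≤ 16 / 15 := by
  have h1 : Real.exp (1 / 16 : ℝ) < 1 / (1 - 1 / 16) := Real.exp_bound_div_one_sub_of_interval' (by norm_num) (by norm_num)
  have h2 : Real.exp x ≤ Real.exp (1 / 16 : ℝ) := Real.exp_le_exp.2 h
  have h3 : (1 : ℝ) / (1 - 1 / 16) = 16 / 15 := by norm_num
  linarith [h3 ▸ h1]

/-- The word derivative `∂^[k]` of the composed field is the chain-rule sum
`Σₘ ∂ₘfᵢ(X) (δₘₖ + ∂ₖDₘ)` (classical chain rule through `X = id + proj ∘ D`).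
[cite: ArmstrongVicol2025, App. A Prop. 7.10 (variational equation (eq:grad:psi))] -/
theorem iterPartialDeriv_singleton_comp_add_proj (hfs : ∀ t, IsSmooth (f t)) (hDs : ∀ t, IsSmooth (D t))
    (k i : d) (u : ℝ) (x : UnitAddTorus d) :
    iterPartialDeriv [k] (fun z => f u (z + proj (D u z)) i) x =
      ∑ m, partialDeriv m (fun z => f u z i) (x + proj (D u x)) *
        ((1 : Matrix d d ℝ) m k + partialDeriv k (fun z => D u z m) x) := by
  classical
  simp only [iterPartialDeriv_cons, iterPartialDeriv_nil]
  rw [partialDeriv_comp_add_proj (((hfs u).apply i).isContDiff (by simp)) ((hDs u).isContDiff (by simp)) k x]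
  refine Finset.sum_congr rfl fun m _ => ?_
  rw [smul_eq_mul, mul_comm, partialDeriv_apply_coord ((hDs u).isContDiff (by simp)) k x m, Matrix.one_apply,
    PiLp.single_apply]

/-- **Prop. 7.10, first display, on `[0,T]`**: `|∂ₖDᵢ(t,x)| ≤ 8 d C_f R_f t` for `0 ≤ t ≤ T = 1/(4dC_fR_f)`
(Grönwall on the variational equation `∂ₜ∇D = (∇f∘X)(1 + ∇D)`, `|∂ₘfᵢ| ≤ C_fR_f/4`, `e^{1/16} < 16/15`).
[cite: ArmstrongVicol2025, App. A Prop. 7.10 ((eq:grad:psi))] -/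
theorem abs_partialDeriv_disp_le_forward_ofDeriv (hCf : 0 < Cf) (hRf : 0 < Rf) (hN : 1 ≤ N)
    (hfs : ∀ t, IsSmooth (f t)) (hDs : ∀ t, IsSmooth (D t)) (hD0 : ∀ x, D 0 x = 0)
    (hDt : ∀ (l : List d) (i : d) (t : ℝ) (x : UnitAddTorus d), HasDerivAt (fun s => iterPartialDeriv l (fun y => D s y i) x)
      (iterPartialDeriv l (fun y => f t (y + proj (D t y)) i) x) t)
    (hfb : ∀ n, 1 ≤ n → n ≤ N → ∀ t, dnorm n Rf (f t) ≤ Cf)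
    {t : ℝ} (ht : t ∈ Icc 0 (1 / (4 * (Fintype.card d : ℝ) * Cf * Rf))) (k i : d) (x : UnitAddTorus d) :
    |partialDeriv k (fun y => D t y i) x| ≤ 8 * (Fintype.card d : ℝ) * Cf * Rf * t := by
  classical
  set dd : ℝ := (Fintype.card d : ℝ) with hdd
  have hdd1 : 1 ≤ dd := by
    have : Nonempty d := ⟨k⟩
    have hcard : 1 ≤ Fintype.card d := Nat.succ_le_of_lt Fintype.card_pos
    rw [hdd]; exact_mod_cast hcard
  -- the curve of the column `(∂ₖDᵢ)ᵢ` in the sup norm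
  set y : ℝ → d → ℝ := fun u i => iterPartialDeriv [k] (fun z => D u z i) x with hy
  set y' : ℝ → d → ℝ := fun u i => iterPartialDeriv [k] (fun z => f u (z + proj (D u z)) i) x with hy'
  have hyd : ∀ u, HasDerivAt y (y' u) u := fun u =>
    hasDerivAt_pi.2 fun i => hDt [k] i u x
  have hy0 : y 0 = 0 := funext fun i => iterPartialDeriv_disp_zero hD0 (l := [k]) (by simp) i x
  have hyk : ∀ u m, partialDeriv k (fun z => D u z m) x = y u m := fun u m => by
    simp only [hy, iterPartialDeriv_cons, iterPartialDeriv_nil]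
  set Kc : ℝ := dd * (Cf * Rf / 4) with hKc
  have hKc0 : 0 ≤ Kc := by positivity
  have hb : ∀ u ∈ Ico 0 (1 / (4 * dd * Cf * Rf)), ‖y' u‖ ≤ Kc * ‖y u‖ + Cf * Rf / 4 := by
    intro u _
    refine (pi_norm_le_iff_of_nonneg (by positivity)).2 fun i => ?_
    rw [Real.norm_eq_abs]
    have hfu : IsSmooth (f u) := hfs u
    have ey : y' u i = ∑ m, partialDeriv m (fun z => f u z i) (x + proj (D u x)) *
        ((1 : Matrix d d ℝ) m k + partialDeriv k (fun z => D u z m) x) :=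
      iterPartialDeriv_singleton_comp_add_proj hfs hDs k i u x
    calc |y' u i| = |∑ m, partialDeriv m (fun z => f u z i) (x + proj (D u x)) *
            ((1 : Matrix d d ℝ) m k + partialDeriv k (fun z => D u z m) x)| := by rw [ey]
      _ ≤ ∑ m, |partialDeriv m (fun z => f u z i) (x + proj (D u x)) *
            ((1 : Matrix d d ℝ) m k + partialDeriv k (fun z => D u z m) x)| := Finset.abs_sum_le_sum_abs _ _
      _ ≤ ∑ m, Cf * Rf / 4 * ((1 : Matrix d d ℝ) m k + |y u m|) := by
          refine Finset.sum_le_sum fun m _ => ?_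
          rw [abs_mul]
          refine mul_le_mul (abs_partialDeriv_apply_le_of_dnorm_one hfu hRf (hfb 1 le_rfl hN u) m i _) ?_
            (abs_nonneg _) (by positivity)
          refine (abs_add_le _ _).trans (add_le_add (le_of_eq ?_) (le_of_eq (by rw [hyk])))
          rw [Matrix.one_apply]; split_ifs <;> simp
      _ = Cf * Rf / 4 * 1 + Cf * Rf / 4 * ∑ m, |y u m| := by
          rw [← Finset.mul_sum, Finset.sum_add_distrib, mul_add]
          congr 2
          rw [Finset.sum_eq_single k (fun m _ hm => by rw [Matrix.one_apply_ne hm]) (fun h => (h (Finset.mem_univ k)).elim),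
            Matrix.one_apply_eq]
      _ ≤ Cf * Rf / 4 * 1 + Cf * Rf / 4 * (dd * ‖y u‖) := by
          gcongr
          calc ∑ m, |y u m| ≤ ∑ _m : d, ‖y u‖ := Finset.sum_le_sum fun m _ => by
                rw [← Real.norm_eq_abs]; exact norm_le_pi_norm (y u) m
            _ = dd * ‖y u‖ := by rw [Finset.sum_const, Finset.card_univ, nsmul_eq_mul]
      _ = Kc * ‖y u‖ + Cf * Rf / 4 := by rw [hKc]; ring
  have hG := norm_le_exp_mul_integral_of_norm_deriv_le hKc0 continuous_const (fun _ => by positivity) hyd hy0 hb ht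
  rw [intervalIntegral.integral_const, smul_eq_mul, sub_zero] at hG
  -- `Kc t ≤ 1/16`
  have hT : t ≤ 1 / (4 * dd * Cf * Rf) := ht.2
  have hKt : Kc * t ≤ 1 / 16 := by
    have h1 : Kc * t ≤ Kc * (1 / (4 * dd * Cf * Rf)) := mul_le_mul_of_nonneg_left hT hKc0
    have h2 : Kc * (1 / (4 * dd * Cf * Rf)) = 1 / 16 := by rw [hKc]; field_simp; ring
    linarith
  have hexp : Real.exp (Kc * t) ≤ 16 / 15 := exp_le_of_le_sixteenth' hKt
  calc |partialDeriv k (fun y => D t y i) x| = |y t i| := by rw [hyk]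
    _ ≤ ‖y t‖ := by rw [← Real.norm_eq_abs]; exact norm_le_pi_norm (y t) i
    _ ≤ Real.exp (Kc * t) * (t * (Cf * Rf / 4)) := hG
    _ ≤ 16 / 15 * (t * (Cf * Rf / 4)) := mul_le_mul_of_nonneg_right hexp (by nlinarith [ht.1, hCf, hRf])
    _ ≤ 8 * dd * Cf * Rf * t := by nlinarith [ht.1, hCf, hRf, hdd1, mul_nonneg (mul_nonneg hCf.le hRf.le) ht.1]

/-! ## §2 The induction on `[0,T]` -/

omit [Fintype d] [DecidableEq d] in
/-- `lift (h(· + proj E ·)) = lift h ∘ (id + lift E)`. [folklore] -/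
private theorem lift_comp_eq'' (h : UnitAddTorus d → ℝ) (E : UnitAddTorus d → EuclideanSpace ℝ d) :
    lift (fun y => h (y + proj (E y))) = lift h ∘ fun v => v + lift E v := by
  funext v
  rw [lift_apply, comp_apply, lift_apply, proj_add, lift_apply]

omit [Fintype d] [DecidableEq d] in
/-- `∫₀ᵗ (1+Bu)ˢ du ≤ (1+Bt)^{s+1}/(B(s+1))` for `B > 0`, `t ≥ 0`. [cite: ArmstrongVicol2025, App. A Prop. 7.11 (Grönwall step)] -/
private theorem integral_one_add_mul_pow_le' {B t : ℝ} (hB : 0 < B) (s : ℕ) :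
    ∫ u in (0 : ℝ)..t, (1 + B * u) ^ s ≤ (1 + B * t) ^ (s + 1) / (B * ((s : ℝ) + 1)) := by
  have hderiv : ∀ u ∈ uIcc 0 t, HasDerivAt (fun u => (1 + B * u) ^ (s + 1) / (B * ((s : ℝ) + 1))) ((1 + B * u) ^ s) u := by
    intro u _
    have h1 : HasDerivAt (fun u => 1 + B * u) B u := by
      simpa using ((hasDerivAt_id u).const_mul B).const_add 1
    have h2 := (h1.pow (s + 1)).div_const (B * ((s : ℝ) + 1))
    refine h2.congr_deriv ?_
    simp only [Nat.add_sub_cancel]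
    field_simp
    push_cast
    ring
  rw [intervalIntegral.integral_eq_sub_of_hasDerivAt hderiv ((continuous_const.add (continuous_const.mul continuous_id)).pow s
    |>.intervalIntegrable 0 t)]
  simp only [mul_zero, add_zero, one_pow]
  have : 0 ≤ 1 / (B * ((s : ℝ) + 1)) := by positivity
  linarith
set_option maxHeartbeats 400000 in
/-- **The inductive bound (eq:Dn:Psi:induction) on `[0,T]`, componentwise**: for `1 ≤ s ≤ N`,
`0 ≤ t ≤ T`, every word `K` of length `s`, every `v` and component `j`,
`|(Dˢ(id + D(t)∘proj)(v)(e_K))_j| ≤ W_s ρ_tˢ/((s+1)² d R_f)`, `ρ_t = 8dR_f(1 + 8dC_fR_f t)`.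
[cite: ArmstrongVicol2025, App. A Prop. 7.11 ((eq:Dn:Psi:induction))] -/
theorem abs_iteratedFDeriv_flow_le_forward_ofDeriv (hCf : 0 < Cf) (hRf : 0 < Rf)
    (hfs : ∀ t, IsSmooth (f t)) (hDs : ∀ t, IsSmooth (D t)) (hD0 : ∀ x, D 0 x = 0)
    (hDt : ∀ (l : List d) (i : d) (t : ℝ) (x : UnitAddTorus d), HasDerivAt (fun s => iterPartialDeriv l (fun y => D s y i) x)
      (iterPartialDeriv l (fun y => f t (y + proj (D t y)) i) x) t)
    (hfb : ∀ n, 1 ≤ n → n ≤ N → ∀ t, dnorm n Rf (f t) ≤ Cf) :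
    ∀ s, 1 ≤ s → s ≤ N → ∀ t ∈ Icc 0 (1 / (4 * (Fintype.card d : ℝ) * Cf * Rf)),
      ∀ (K : Fin s → d) (v : EuclideanSpace ℝ d) (j : d),
        |(iteratedFDeriv ℝ s (fun w => w + lift (D t) w) v (fun i => EuclideanSpace.single (K i) (1 : ℝ))) j| ≤
          ((1 / 2 : ℝ) * ∏ i ∈ Finset.range (s - 1), ((i : ℝ) + 1 / 2)) *
            (8 * (Fintype.card d : ℝ) * Rf * (1 + 8 * (Fintype.card d : ℝ) * Cf * Rf * t)) ^ s /
            (((s : ℝ) + 1) ^ 2 * ((Fintype.card d : ℝ) * Rf)) := by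
  classical
  intro s
  induction s using Nat.strong_induction_on with
  | h s ih =>
  intro hs1 hsN t ht K v j
  set dd : ℝ := (Fintype.card d : ℝ) with hdd
  have hdd1 : 1 ≤ dd := by
    have : Nonempty d := ⟨j⟩
    have hcard : 1 ≤ Fintype.card d := Nat.succ_le_of_lt Fintype.card_pos
    rw [hdd]; exact_mod_cast hcard
  set B : ℝ := 8 * dd * Cf * Rf with hB
  have hB0 : 0 < B := by positivity
  rcases Nat.lt_or_ge s 2 with hs | hs
  · ----- base `s = 1`
    obtain rfl : s = 1 := by omega
    rw [iteratedFDeriv_one_inner_eq (hDs t) K v]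
    have hb := abs_partialDeriv_disp_le_forward_ofDeriv hCf hRf hsN hfs hDs hD0 hDt hfb ht (K 0) j (proj v)
    simp only [Nat.sub_self, Finset.range_zero, Finset.prod_empty, mul_one, pow_one, Nat.cast_one]
    rw [PiLp.add_apply, PiLp.single_apply 2 ℝ (K 0) (1 : ℝ) j, partialDeriv_apply_coord ((hDs t).isContDiff (by simp))] at *
    have e : (1 / 2 : ℝ) * (8 * dd * Rf * (1 + 8 * dd * Cf * Rf * t)) / ((1 + 1) ^ 2 * (dd * Rf)) = 1 + B * t := by
      rw [hB]; field_simp; ring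
    rw [← partialDeriv_apply_coord ((hDs t).isContDiff (by simp))] at hb ⊢
    rw [e]
    refine (abs_add_le _ _).trans (add_le_add ?_ ?_)
    · split_ifs <;> simp
    · calc |partialDeriv (K 0) (fun y => D t y j) (proj v)| ≤ 8 * dd * Cf * Rf * t := hb
        _ = B * t := by rw [hB]
  · ----- step `s ≥ 2`
    set x : UnitAddTorus d := proj v with hx
    have hKne : List.ofFn K ≠ [] := by
      intro h; have := congrArg List.length h; simp at this; omega
    -- the curve of the word derivative, all components, sup norm
    set y : ℝ → d → ℝ := fun u i => iterPartialDeriv (List.ofFn K) (fun z => D u z i) x with hy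
    set y' : ℝ → d → ℝ := fun u i => iterPartialDeriv (List.ofFn K) (fun z => f u (z + proj (D u z)) i) x with hy'
    have hyd : ∀ u, HasDerivAt y (y' u) u := fun u =>
      hasDerivAt_pi.2 fun i => hDt (List.ofFn K) i u x
    have hy0 : y 0 = 0 := funext fun i => iterPartialDeriv_disp_zero hD0 hKne i x
    -- constants
    set Kc : ℝ := dd * (Cf * Rf / 4) with hKc
    have hKc0 : 0 ≤ Kc := by positivity
    set Ws : ℝ := (1 / 2 : ℝ) * ∏ i ∈ Finset.range (s - 1), ((i : ℝ) + 1 / 2) with hWs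
    have hWs0 : 0 < Ws := avWeight_pos s
    set ε : ℝ → ℝ := fun u => Cf * (8 * dd * Rf * (1 + B * |u|)) ^ s / ((s : ℝ) + 1) ^ 2 *
      ∏ i ∈ Finset.range s, ((i : ℝ) + 1 / 2) with hε
    have hP0 : 0 ≤ ∏ i ∈ Finset.range s, ((i : ℝ) + 1 / 2) := Finset.prod_nonneg fun i _ => by positivity
    have hε0 : ∀ u, 0 ≤ ε u := fun u => by
      simp only [hε]
      positivity
    have hεc : Continuous ε := by
      simp only [hε]
      fun_prop
    -- the differential inequality
    have hb : ∀ u ∈ Ico 0 (1 / (4 * dd * Cf * Rf)), ‖y' u‖ ≤ Kc * ‖y u‖ + ε u := by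
      intro u hu
      have huI : u ∈ Icc 0 (1 / (4 * dd * Cf * Rf)) := Ico_subset_Icc_self hu
      refine (pi_norm_le_iff_of_nonneg (by positivity [hε0 u])).2 fun i => ?_
      rw [Real.norm_eq_abs]
      have hfu : IsSmooth (f u) := hfs u
      have hψ : IsSmooth (fun z => f u z i) := hfu.apply i
      have hG : ContDiff ℝ ∞ (fun w : EuclideanSpace ℝ d => w + lift (D u) w) := contDiff_id.add (hDs u)
      -- the word derivative of the composition as an iterated Fréchet derivative of the lifted composition
      have hcomp : IsSmooth (fun z => f u (z + proj (D u z)) i) := (isSmooth_comp_add_proj hfu (hDs u)).apply i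
      have e1 : y' u i = iteratedFDeriv ℝ s (lift (fun z => f u z i) ∘ fun w => w + lift (D u) w) v
          (fun t => EuclideanSpace.single (K t) (1 : ℝ)) := by
        simp only [hy']
        rw [← lift_comp_eq'' (fun z => f u z i) (D u), iteratedFDeriv_lift_apply_single hcomp s K v]
      -- the remainder bound (E_old)
      have hrem := norm_faaDiBrunoRemainder_le_of_coord (n := s) hs hψ hG hCf.le hRf
        (ρ := 8 * dd * Rf * (1 + B * u))
        (mul_nonneg (by positivity) (by nlinarith [mul_nonneg hB0.le hu.1])) (b := 1 / 2)
        (fun s' => (1 / 2 : ℝ) * ∏ i ∈ Finset.range (s' - 1), ((i : ℝ) + 1 / 2)) (fun s' => (avWeight_pos s').le)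
        avWeight_one (fun s' hs' => avWeight_succ hs')
        (fun k hk hks => (dnorm_apply_le k hRf.le hfu i).trans (hfb k hk (hks.trans hsN) u))
        (fun s' hs' hs's K' v' j' => by
          have h := ih s' (by omega) hs' (by omega) u huI K' v' j'
          simpa only [hdd, hB] using h)
        K v
      -- the linear term
      have hlin : |_root_.fderiv ℝ (lift fun z => f u z i) (v + lift (D u) v)
          (iteratedFDeriv ℝ s (fun w => w + lift (D u) w) v (fun t => EuclideanSpace.single (K t) (1 : ℝ)))| ≤
          Kc * ‖y u‖ := by
        rw [fderiv_lift_apply_eq_sum (hψ.isContDiff (by simp)), iteratedFDeriv_inner_eq_iterPartialDeriv (hDs u) hs K v]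
        calc |∑ k, (iterPartialDeriv (List.ofFn K) (D u) (proj v)) k • partialDeriv k (fun z => f u z i) (proj (v + lift (D u) v))|
            ≤ ∑ k, |(iterPartialDeriv (List.ofFn K) (D u) (proj v)) k • partialDeriv k (fun z => f u z i) (proj (v + lift (D u) v))| :=
              Finset.abs_sum_le_sum_abs _ _
          _ ≤ ∑ k, ‖y u‖ * (Cf * Rf / 4) := by
              refine Finset.sum_le_sum fun k _ => ?_
              rw [smul_eq_mul, abs_mul]
              refine mul_le_mul ?_ (abs_partialDeriv_apply_le_of_dnorm_one hfu hRf (hfb 1 le_rfl (by omega) u) k i _)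
                (abs_nonneg _) (norm_nonneg _)
              have : (iterPartialDeriv (List.ofFn K) (D u) (proj v)) k = y u k := by
                simp only [hy, hx]
                rw [iterPartialDeriv_apply_coord (hDs u) k]
              rw [this, ← Real.norm_eq_abs]
              exact norm_le_pi_norm (y u) k
          _ = Kc * ‖y u‖ := by rw [Finset.sum_const, Finset.card_univ, nsmul_eq_mul, hKc, hdd]; ring
      -- assemble
      have hsplit : y' u i = _root_.fderiv ℝ (lift fun z => f u z i) (v + lift (D u) v)
            (iteratedFDeriv ℝ s (fun w => w + lift (D u) w) v (fun t => EuclideanSpace.single (K t) (1 : ℝ))) +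
          (iteratedFDeriv ℝ s (lift (fun z => f u z i) ∘ fun w => w + lift (D u) w) v (fun t => EuclideanSpace.single (K t) (1 : ℝ)) -
            _root_.fderiv ℝ (lift fun z => f u z i) (v + lift (D u) v)
              (iteratedFDeriv ℝ s (fun w => w + lift (D u) w) v (fun t => EuclideanSpace.single (K t) (1 : ℝ)))) := by
        rw [e1]; ring
      rw [hsplit]
      refine (abs_add_le _ _).trans (add_le_add hlin ?_)
      rw [← Real.norm_eq_abs]
      refine hrem.trans (le_of_eq ?_)
      simp only [hε, abs_of_nonneg hu.1]
    -- Grönwall with forcing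
    have hG := norm_le_exp_mul_integral_of_norm_deriv_le hKc0 hεc hε0 hyd hy0 hb ht
    -- the integral of the forcing
    have hT2 : B * t ≤ 2 := by
      have h1 : B * t ≤ B * (1 / (4 * dd * Cf * Rf)) := mul_le_mul_of_nonneg_left ht.2 hB0.le
      have h2 : B * (1 / (4 * dd * Cf * Rf)) = 2 := by rw [hB]; field_simp; ring
      linarith
    have hI : ∫ u in (0 : ℝ)..t, ε u ≤ Cf * (8 * dd * Rf) ^ s / ((s : ℝ) + 1) ^ 2 *
        (∏ i ∈ Finset.range s, ((i : ℝ) + 1 / 2)) * ((1 + B * t) ^ (s + 1) / (B * ((s : ℝ) + 1))) := by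
      have e : ∫ u in (0 : ℝ)..t, ε u = ∫ u in (0 : ℝ)..t, (Cf * (8 * dd * Rf) ^ s / ((s : ℝ) + 1) ^ 2 *
          ∏ i ∈ Finset.range s, ((i : ℝ) + 1 / 2)) * (1 + B * u) ^ s := by
        refine intervalIntegral.integral_congr fun u hu => ?_
        rw [uIcc_of_le ht.1] at hu
        simp only [hε, abs_of_nonneg hu.1]
        rw [mul_pow]
        ring
      rw [e, intervalIntegral.integral_const_mul]
      exact mul_le_mul_of_nonneg_left (integral_one_add_mul_pow_le' hB0 s) (by positivity)
    -- `e^{Kc t} ≤ 16/15`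
    have hKt : Kc * t ≤ 1 / 16 := by
      have h1 : Kc * t ≤ Kc * (1 / (4 * dd * Cf * Rf)) := mul_le_mul_of_nonneg_left ht.2 hKc0
      have h2 : Kc * (1 / (4 * dd * Cf * Rf)) = 1 / 16 := by rw [hKc]; field_simp; ring
      linarith
    have hexp : Real.exp (Kc * t) ≤ 16 / 15 := exp_le_of_le_sixteenth' hKt
    -- identify the left side with `|y t j|`
    have hyj : (iteratedFDeriv ℝ s (fun w => w + lift (D t) w) v (fun i => EuclideanSpace.single (K i) (1 : ℝ))) j = y t j := by
      rw [iteratedFDeriv_inner_eq_iterPartialDeriv (hDs t) hs K v]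
      simp only [hy, hx]
      rw [iterPartialDeriv_apply_coord (hDs t) j]
    rw [hyj]
    have hI0 : 0 ≤ ∫ u in (0 : ℝ)..t, ε u := intervalIntegral.integral_nonneg ht.1 fun u _ => hε0 u
    -- the closing arithmetic
    have hratio : 2 * ((s : ℝ) - 1 / 2) / ((s : ℝ) + 1) ≤ 2 := by
      rw [div_le_iff₀ (by positivity)]; linarith
    have hratio0 : 0 ≤ 2 * ((s : ℝ) - 1 / 2) / ((s : ℝ) + 1) := by
      apply div_nonneg _ (by positivity)
      have : (2 : ℝ) ≤ s := by exact_mod_cast hs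
      linarith
    have e8 : Cf * dd * Rf / B = 1 / 8 := by
      rw [div_eq_iff hB0.ne', hB]; ring
    have h1t : 0 ≤ 1 + B * t := by nlinarith [mul_nonneg hB0.le ht.1]
    have hρs : (8 * dd * Rf * (1 + 8 * dd * Cf * Rf * t)) ^ s = (8 * dd * Rf) ^ s * (1 + B * t) ^ s := by
      rw [← mul_pow, hB]
    set M : ℝ := Ws * (8 * dd * Rf * (1 + 8 * dd * Cf * Rf * t)) ^ s / (((s : ℝ) + 1) ^ 2 * (dd * Rf)) with hM
    have hM0 : 0 ≤ M := by
      rw [hM, hρs]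
      exact div_nonneg (mul_nonneg hWs0.le (mul_nonneg (by positivity) (pow_nonneg h1t s))) (by positivity)
    have e2 : 16 / 15 * (Cf * (8 * dd * Rf) ^ s / ((s : ℝ) + 1) ^ 2 *
        (∏ i ∈ Finset.range s, ((i : ℝ) + 1 / 2)) * ((1 + B * t) ^ (s + 1) / (B * ((s : ℝ) + 1)))) =
        M * (16 / 15 * (2 * ((s : ℝ) - 1 / 2) / ((s : ℝ) + 1)) * (1 + B * t) * (Cf * dd * Rf / B)) := by
      rw [prod_range_half_eq (by omega : 1 ≤ s), ← hWs, hM, hρs, pow_succ]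
      set A : ℝ := (8 * dd * Rf) ^ s
      set P : ℝ := (1 + B * t) ^ s
      field_simp
      ring
    calc |y t j| ≤ ‖y t‖ := by rw [← Real.norm_eq_abs]; exact norm_le_pi_norm (y t) j
      _ ≤ Real.exp (Kc * t) * ∫ u in (0 : ℝ)..t, ε u := hG
      _ ≤ 16 / 15 * (Cf * (8 * dd * Rf) ^ s / ((s : ℝ) + 1) ^ 2 *
          (∏ i ∈ Finset.range s, ((i : ℝ) + 1 / 2)) * ((1 + B * t) ^ (s + 1) / (B * ((s : ℝ) + 1)))) :=
          mul_le_mul hexp hI hI0 (by norm_num)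
      _ = M * (16 / 15 * (2 * ((s : ℝ) - 1 / 2) / ((s : ℝ) + 1)) * (1 + B * t) * (Cf * dd * Rf / B)) := e2
      _ ≤ M * 1 := by
          refine mul_le_mul_of_nonneg_left ?_ hM0
          rw [e8]
          have h1t : 0 ≤ 1 + B * t := by nlinarith [ht.1, hB0]
          calc 16 / 15 * (2 * ((s : ℝ) - 1 / 2) / ((s : ℝ) + 1)) * (1 + B * t) * (1 / 8)
              ≤ 16 / 15 * 2 * 3 * (1 / 8) := by
                have := mul_le_mul hratio (by linarith : 1 + B * t ≤ 3) h1t (by norm_num)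
                nlinarith [this, hratio0, h1t]
            _ ≤ 1 := by norm_num
      _ = M := mul_one M

/-! ## §3 The `dnorm` packaging on `[0,T]` -/

/-- **Armstrong–Vicol, App. A Prop. 7.11 on the forward window, time-regularity as data**: for the flow
`X = id + proj∘D` (smooth slices, `∂ₜ∂^l D = ∂^l(f∘X)` for every word `l`, `D(0) = 0`) of a field with
`⟦f(t)⟧_{n,R_f} ≤ C_f` (`1 ≤ n ≤ N`), every `0 ≤ t ≤ 1/(4dC_fR_f)` and `1 ≤ n ≤ N − 1`:
`⟦(∇X)_{ij}(t,·)⟧_{n, 8dR_f(1+8dC_fR_f t)} ≤ 6d`.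
[cite: ArmstrongVicol2025, App. A Prop. 7.11 ((e.ODE.flow.estimate), arXiv §7.3 pp. 73–74)] -/
theorem dnorm_flowGrad_le_forward_ofDeriv (hCf : 0 < Cf) (hRf : 0 < Rf)
    (hfs : ∀ t, IsSmooth (f t)) (hDs : ∀ t, IsSmooth (D t)) (hD0 : ∀ x, D 0 x = 0)
    (hDt : ∀ (l : List d) (i : d) (t : ℝ) (x : UnitAddTorus d), HasDerivAt (fun s => iterPartialDeriv l (fun y => D s y i) x)
      (iterPartialDeriv l (fun y => f t (y + proj (D t y)) i) x) t)
    (hfb : ∀ n, 1 ≤ n → n ≤ N → ∀ t, dnorm n Rf (f t) ≤ Cf) :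
    ∀ n, 1 ≤ n → n + 1 ≤ N → ∀ t ∈ Icc (0 : ℝ) (1 / (4 * (Fintype.card d : ℝ) * Cf * Rf)),
      ∀ i j : d, dnorm n (8 * (Fintype.card d : ℝ) * Rf * (1 + 8 * (Fintype.card d : ℝ) * Cf * Rf * t))
          (fun y => (1 : Matrix d d ℝ) i j + partialDeriv j (fun x => D t x i) y) ≤
        6 * (Fintype.card d : ℝ) := by
  intro n hn1 hnN t ht i j
  classical
  set dd : ℝ := (Fintype.card d : ℝ) with hdd
  have hdd1 : 1 ≤ dd := by
    have : Nonempty d := ⟨i⟩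
    have hcard : 1 ≤ Fintype.card d := Nat.succ_le_of_lt Fintype.card_pos
    rw [hdd]; exact_mod_cast hcard
  set ρ : ℝ := 8 * dd * Rf * (1 + 8 * dd * Cf * Rf * t) with hρ
  have ht0 : 0 ≤ t := ht.1
  have hBt : 8 * dd * Cf * Rf * t ≤ 2 := by
    have h1 : 8 * dd * Cf * Rf * t ≤ 8 * dd * Cf * Rf * (1 / (4 * dd * Cf * Rf)) :=
      mul_le_mul_of_nonneg_left ht.2 (by positivity)
    have h2 : 8 * dd * Cf * Rf * (1 / (4 * dd * Cf * Rf)) = 2 := by field_simp; ring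
    linarith
  have hρ0 : 0 < ρ := by positivity
  have hρle : ρ ≤ 24 * dd * Rf := by
    rw [hρ]; nlinarith [hBt, mul_pos (mul_pos (by norm_num : (0:ℝ) < 8) (by linarith : (0:ℝ) < dd)) hRf]
  have hDti : IsSmooth (fun x => D t x i) := (hDs t).apply i
  refine dnorm_le_of_forall_norm_iterPartialDeriv_le hρ0 (by positivity) fun l hl y => ?_
  obtain ⟨v, rfl⟩ := proj_surjective y
  have hlne : l ≠ [] := by intro h; subst h; simp at hl; omega
  -- `∂^l (δ_ij + ∂_j D_i) = ∂^{l ++ [j]} D_i`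
  have e1 : iterPartialDeriv l (fun y => (1 : Matrix d d ℝ) i j + partialDeriv j (fun x => D t x i) y) (proj v) =
      iterPartialDeriv (l ++ [j]) (fun x => D t x i) (proj v) := by
    rw [iterPartialDeriv_concat,
      iterPartialDeriv_add (isSmooth_const ((1 : Matrix d d ℝ) i j)) (hDti.partialDeriv j) l]
    simp only
    rw [iterPartialDeriv_const ((1 : Matrix d d ℝ) i j) l hlne, Pi.zero_apply, zero_add]
  -- the word `l ++ [j]` of length `n + 1` as `List.ofFn K`
  have hlen : (l ++ [j]).length = n + 1 := by simp [hl]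
  set K : Fin (n + 1) → d := fun k => (l ++ [j]).get (Fin.cast hlen.symm k) with hK
  have eK : List.ofFn K = l ++ [j] := by
    refine List.ext_get (by rw [List.length_ofFn, hlen]) fun k h1 h2 => ?_
    rw [List.get_ofFn]
    rfl
  have e2 : iterPartialDeriv (l ++ [j]) (fun x => D t x i) (proj v) =
      (iteratedFDeriv ℝ (n + 1) (fun w => w + lift (D t) w) v (fun k => EuclideanSpace.single (K k) (1 : ℝ))) i := by
    rw [iteratedFDeriv_inner_eq_iterPartialDeriv (hDs t) (by omega) K v, eK, iterPartialDeriv_apply_coord (hDs t) i]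
  have key := abs_iteratedFDeriv_flow_le_forward_ofDeriv hCf hRf hfs hDs hD0 hDt hfb (n + 1) (by omega) hnN t ht K v i
  rw [Real.norm_eq_abs, e1, e2]
  refine key.trans ?_
  rw [← hdd, ← hρ]
  -- arithmetic: `W_{n+1} ρ^{n+1}/((n+2)² d R_f) ≤ 6d · n! ρⁿ/(n+1)²`
  have hW := four_mul_avWeight_succ_le_factorial hn1
  have hW0 := (avWeight_pos (n + 1)).le
  set W : ℝ := (1 / 2 : ℝ) * ∏ i ∈ Finset.range (n + 1 - 1), ((i : ℝ) + 1 / 2) with hWdef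
  have hn2 : ((n : ℝ) + 1) ^ 2 ≤ (((n + 1 : ℕ) : ℝ) + 1) ^ 2 := by
    push_cast; nlinarith [(Nat.cast_nonneg n : (0 : ℝ) ≤ n)]
  calc W * ρ ^ (n + 1) / ((((n + 1 : ℕ) : ℝ) + 1) ^ 2 * (dd * Rf))
      = (W * ρ) * (ρ ^ n / ((((n + 1 : ℕ) : ℝ) + 1) ^ 2 * (dd * Rf))) := by rw [pow_succ]; ring
    _ ≤ ((n ! : ℝ) / 4 * (24 * dd * Rf)) * (ρ ^ n / (((n : ℝ) + 1) ^ 2 * (dd * Rf))) := by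
        refine mul_le_mul ?_ ?_ (by positivity) (by positivity)
        · exact mul_le_mul (by linarith) hρle hρ0.le (by positivity)
        · exact div_le_div_of_nonneg_left (by positivity) (by positivity)
            (mul_le_mul_of_nonneg_right hn2 (by positivity))
    _ = 6 * ((n ! : ℝ) * ρ ^ n) / ((n : ℝ) + 1) ^ 2 := by field_simp; norm_num
    _ ≤ 6 * dd * ((n ! : ℝ) * ρ ^ n) / ((n : ℝ) + 1) ^ 2 := by
        refine div_le_div_of_nonneg_right ?_ (by positivity)
        nlinarith [hdd1, show 0 ≤ (n ! : ℝ) * ρ ^ n by positivity]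

end TorusFlow

end Literature.Analysis.ODE

end
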